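import Summits.BirchSwinnertonDyer.BirchSwinnertonDyer.Theorems.PlecticLegsTwistSupplyStubCycloGlue
import Literature.NumberTheory.EllipticCurves.NonvanishingTwistsHoffsteinLuo
import Literature.NumberTheory.EllipticCurves.QuadraticTwistKroneckerRootNumberProofs
import Literature.NumberTheory.EllipticCurves.BSDRootNumberOddParityProofs
import Literature.NumberTheory.EllipticCurves.AnalyticRankModularityProofs
import HarnessLib

/-!
# Stub `stub_rankTwo` (line `Sketch` = `kurihara-fourier-support`, crux `PlecticLegs.TwistSupply`)

**The known case `r_an(E) = 2` of the twist supply: a silent real quadratic field.** For an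
elliptic `W / ℚ` of analytic rank `2`, assuming the Modularity Theorem (`exists_isNewformOf`) and
Hoffstein–Luo 1997 (`HoffsteinLuo1997_exists_twist_L_one_ne_zero`) as hypotheses, there is a
positive square-free `d ≡ 1 (mod 8)`, `d > 1`, prime to `N = N_W`, with `L(W^{(d)}, 1) ≠ 0`; the
Kronecker character `χ_d = (· / d)` mod `m = d` is even, quadratic, primitive and non-trivial, so
(`stub_cycloGlue`) it cuts out a totally real field `F = ℚ(√d) ⊆ ℚ(ζ_d)` of degree
`ord χ_d = 2 = r_an(W)` whose only non-trivial character is `χ_d`, and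
`L(W, χ_d, s) = ∑ χ_d(n) aₙ(W) n^{-s} = L(W^{(d)}, s)` (`aₙ(W^{(d)}) = (n / d) aₙ(W)`,
`LFunction_quadraticTwist_apply_of_int_gcd_eq_one`) is entire (modularity) and non-zero at `1`.

The sign bookkeeping forcing `d > 0` (Murty–Murty 1997, Ch. 6, p. 96): `w(W) = 1` since `r_an(W)`
is even (`rootNumber_eq_one_of_even_analyticRank`, unconditional); Hoffstein–Luo is applied with
`S = ` the primes of `N` and bound `B = 1`, so `(d / ℓ) = 1` for the odd `ℓ ∣ N` and
`d ≡ 1 (mod 8)`, whence `(d, N) = 1` and `χ_d(N) = (N / |d|) = 1`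
(`jacobiChar_natAbs_natCast_eq_one_of_forall_prime`); if `d < 0` then `|d| ≡ 3 (mod 4)`,
`χ_d(−1) = −1`, the sign of `L(W^{(d)}, s) = L(W ⊗ χ_d, s)` is `w(W) χ_d(−1) χ_d(N) = −1` and
`L(W^{(d)}, 1) = 0` (`entireLFunction_one_eq_zero_of_twist_sign`), contradicting Hoffstein–Luo.
-/

noncomputable section

set_option linter.dupNamespace false

namespace Summit.BirchSwinnertonDyer.BirchSwinnertonDyer.Theorems

open CongruenceSubgroup WeierstrassCurve Literature.NumberTheory.EllipticCurves
  Literature.NumberTheory.EllipticCurves.ModularForms Literature.NumberTheory.QuadraticFields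

open scoped MatrixGroups ModularForm Classical NumberTheorySymbols

/-! ### Hoffstein–Luo's discriminant is positive when `w(W) = 1` -/

/-- **A positive non-vanishing twist for root number `+1`.** For `W / ℚ` elliptic with `w(W) = 1`,
assuming modularity and Hoffstein–Luo: there is a square-free `d > 1`, `d ≡ 1 (mod 8)`, prime to
`N_W`, with `L(W^{(d)}, 1) ≠ 0`. Hoffstein–Luo (with `S` the primes of `N_W`, bound `1`) gives
`d` up to sign; `d < 0` is excluded by the sign of the functional equation of the twist
(`entireLFunction_one_eq_zero_of_twist_sign` with `χ_d(−1) = −1`, `χ_d(N_W) = 1`). -/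
theorem rankTwo_exists_pos_twist (hmod : exists_isNewformOf)
    (hHL : HoffsteinLuo1997_exists_twist_L_one_ne_zero) (W : WeierstrassCurve ℚ) [W.IsElliptic]
    (hw : W.rootNumber = 1) :
    ∃ d : ℤ, 1 < d ∧ Squarefree d ∧ d % 8 = 1 ∧ Int.gcd d (W.conductorNorm ℤ) = 1 ∧
      (W.quadraticTwist (d : ℚ)).entireLFunction 1 ≠ 0 := by
  set N : ℕ := W.conductorNorm ℤ with hN
  have hN0 : N ≠ 0 := (W.conductorNorm_pos_holds).ne'
  obtain ⟨d, hBd, hsq, hd8, -, hjac, hL⟩ := hHL W N.primeFactors 1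
  have hjac' : ∀ p : ℕ, p.Prime → p ∣ N → p ≠ 2 → jacobiSym d p = 1 := fun p hp hpN hp2 ↦
    hjac p (Nat.mem_primeFactors.mpr ⟨hp, hpN, hN0⟩) hp hp2
  have hd4 : d % 4 = 1 := by omega
  have hd2 : ¬ (2 : ℤ) ∣ d := by omega
  have hgcd : Int.gcd d N = 1 := int_gcd_eq_one_of_forall_jacobiSym_eq_one hd2 hjac'
  -- the sign argument: `d < 0` is impossible
  have hdpos : 0 < d := by
    by_contra hd0
    have hd0' : d < 0 := lt_of_le_of_ne (not_lt.mp hd0) hsq.ne_zero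
    haveI : NeZero d.natAbs := ⟨Int.natAbs_ne_zero.mpr hsq.ne_zero⟩
    have hmd : (d.natAbs : ℤ) = -d := Int.ofNat_natAbs_of_nonpos hd0'.le
    have hm3 : d.natAbs % 4 = 3 := by omega
    have hmodd : Odd d.natAbs := Nat.odd_iff.mpr (by omega)
    have hmsq : Squarefree d.natAbs := Int.squarefree_natAbs.mpr hsq
    have hNm : N.Coprime d.natAbs := by
      rw [Nat.Coprime, Nat.gcd_comm]
      simpa [Int.gcd] using hgcd
    have hco : ∀ n : ℕ, ((W.quadraticTwist (d : ℚ)).LFunction n : ℂ) =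
        jacobiChar d.natAbs n * (W.LFunction n : ℂ) := fun n ↦ by
      rw [LFunction_quadraticTwist_apply_of_int_gcd_eq_one W hd4 hsq hgcd n, Int.cast_mul,
        jacobiChar_natCast]
    have hχN : jacobiChar d.natAbs N = 1 :=
      jacobiChar_natAbs_natCast_eq_one_of_forall_prime hd4 hN0
        fun p hp hpN ↦ ⟨fun _ ↦ hd8, fun hp2 ↦ hjac' p hp hpN hp2⟩
    have hsign : (W.rootNumber : ℂ) * jacobiChar d.natAbs (-1) * jacobiChar d.natAbs N = -1 := by
      rw [hw, jacobiChar_neg_one_of_mod_four_eq_three hm3, hχN]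
      push_cast
      ring
    exact hL (entireLFunction_one_eq_zero_of_twist_sign W hmod hNm isQuadratic_jacobiChar
      (isPrimitive_jacobiChar hmodd hmsq) (W.quadraticTwist (d : ℚ)) hco hsign)
  have hmd : (d.natAbs : ℤ) = d := Int.natAbs_of_nonneg hdpos.le
  exact ⟨d, by omega, hsq, hd8, hgcd, hL⟩

/-! ### The stub -/

/-- **The case `r_an(W) = 2` of the twist supply** (registered stub `stub_rankTwo` of line
`Sketch`): assuming the Modularity Theorem `exists_isNewformOf` and Hoffstein–Luo 1997
`HoffsteinLuo1997_exists_twist_L_one_ne_zero`, every elliptic `W / ℚ` with `r_an(W) = 2` admits a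
modulus `m` and a subgroup `H ≤ Gal(ℚ(ζ_m)/ℚ)` with totally real fixed field of degree
`2 = r_an(W)` all of whose non-trivial characters `χ` have `L(W, χ, s)` entire and non-zero at
`s = 1`. Take `m = d` from `rankTwo_exists_pos_twist` (`w(W) = 1` by
`rootNumber_eq_one_of_even_analyticRank`) and `H = ker χ_d` from `stub_cycloGlue` applied to the
even primitive quadratic character `χ_d = jacobiChar d ≠ 1` (`ord χ_d = 2`); the one non-trivial
character trivial on `H` is `χ_d`, and `L(W, χ_d, s) = L(W^{(d)}, s)`
(`LFunction_quadraticTwist_apply_of_int_gcd_eq_one`) is entire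
(`hasEntireLFunction_rat_of_exists_isNewformOf`) with `L(W^{(d)}, 1) ≠ 0`. -/
theorem stub_rankTwo :
    exists_isNewformOf → HoffsteinLuo1997_exists_twist_L_one_ne_zero →
    ∀ (W : WeierstrassCurve ℚ) [W.IsElliptic], W.analyticRank = 2 →
      ∃ (m : ℕ) (_ : NeZero m),
        ∃ H : Subgroup (CyclotomicField m ℚ ≃ₐ[ℚ] CyclotomicField m ℚ),
          NumberField.IsTotallyReal ↥(IntermediateField.fixedField H) ∧
          Module.finrank ℚ ↥(IntermediateField.fixedField H) = W.analyticRank ∧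
          ∀ χ : DirichletCharacter ℂ m,
            (∀ σ ∈ H, ∀ a : ℕ, (∀ z : CyclotomicField m ℚ, z ^ m = 1 → σ z = z ^ a) →
              χ (a : ZMod m) = 1) → χ ≠ 1 →
            ∃ L : ℂ → ℂ, Differentiable ℂ L ∧
              (∀ s : ℂ, 2 < s.re → L s = LSeries (fun n ↦ χ n * ((W.LFunction n : ℤ) : ℂ)) s) ∧
              L 1 ≠ 0 := by
  intro hmod hHL W _ hr
  have hw : W.rootNumber = 1 :=
    W.rootNumber_eq_one_of_even_analyticRank (by rw [hr]; exact even_two)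
  obtain ⟨d, hd1, hsq, hd8, hgcd, hL⟩ := rankTwo_exists_pos_twist hmod hHL W hw
  have hd4 : d % 4 = 1 := by omega
  -- the modulus `m = d` and the Kronecker character `χ_d = (· / d)`
  set m : ℕ := d.natAbs with hm
  have hmd : (m : ℤ) = d := Int.natAbs_of_nonneg (by omega)
  haveI hm0 : NeZero m := ⟨by omega⟩
  have hm4 : m % 4 = 1 := by omega
  have hm1 : m ≠ 1 := by omega
  have hmodd : Odd m := Nat.odd_iff.mpr (by omega)
  have hmsq : Squarefree m := Int.squarefree_natAbs.mpr hsq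
  have heven : (jacobiChar m).Even := jacobiChar_neg_one_of_mod_four_eq_one hm4
  have horder : orderOf (jacobiChar m) = 2 :=
    orderOf_eq_prime isQuadratic_jacobiChar.sq_eq_one (jacobiChar_ne_one hmodd hmsq hm1)
  -- the twisted `L`-function `L(W, χ_d, s) = L(W^{(d)}, s)`
  haveI : (W.quadraticTwist (d : ℚ)).IsElliptic :=
    W.isElliptic_quadraticTwist (by exact_mod_cast (show d ≠ 0 by omega))
  have hE : (W.quadraticTwist (d : ℚ)).HasEntireLFunction :=
    hasEntireLFunction_rat_of_exists_isNewformOf hmod _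
  have hco : ∀ n : ℕ, ((W.quadraticTwist (d : ℚ)).LFunction n : ℂ) =
      jacobiChar m n * (W.LFunction n : ℂ) := fun n ↦ by
    rw [LFunction_quadraticTwist_apply_of_int_gcd_eq_one W hd4 hsq hgcd n, Int.cast_mul,
      jacobiChar_natCast]
  -- the Galois packaging
  obtain ⟨H, hreal, hdeg, hchar⟩ := stub_cycloGlue m (jacobiChar m) heven
  refine ⟨m, hm0, H, hreal, by rw [hdeg, horder, hr], fun χ hχH hne ↦ ?_⟩
  obtain ⟨j, hj⟩ := hchar χ hχH
  have hχ : χ = jacobiChar m := by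
    rcases Nat.even_or_odd j with hj2 | hj2
    · exact absurd (hj.trans (isQuadratic_jacobiChar.pow_even hj2)) hne
    · exact hj.trans (isQuadratic_jacobiChar.pow_odd hj2)
  refine ⟨(W.quadraticTwist (d : ℚ)).entireLFunction, differentiable_entireLFunction _ hE,
    fun s hs ↦ ?_, hL⟩
  rw [entireLFunction_eq_LSeries _ hE (by linarith), WeierstrassCurve.LSeries]
  congr 1
  funext n
  rw [Function.comp_apply, hco n, hχ]

end Summit.BirchSwinnertonDyer.BirchSwinnertonDyer.Theorems

end
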